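import Summits.BirchSwinnertonDyer.BirchSwinnertonDyer.Theorems.CyclotomicUntwistUntwistedNonvanishingCofinite
import Literature.NumberTheory.EllipticCurves.PAdicLFunctionMultiplicativeInterpolation
import HarnessLib

/-!
# Twisted plus-symbol sums of an elliptic curve vanish at only finitely many even characters of
# `p`-power conductor — ANY prime `p`; the `p`-adic `L`-function at a MULTIPLICATIVE prime is `≠ 0`

Cell `pub/bsd-wall` (D-0145 line `route-BirchSwinnertonDyer-CyclotomicUntwist`), seat `bsd-line-cycu-p5`
(width seat 5), helper toward crux K1 `PSRankOneLowerHalfAtThree` (stmt-BirchSwinnertonDyer-21580); the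
last two theorems are a route-free by-product for the multiplicative-prime lanes of the cell (W-ALL
rows X11b / X5, where `IsMultPAdicLFunctionOf` is the currency). THEOREMS ONLY (no definition, no named
fact, no `sorry`); BSD is not proved by this file and no crux is.

With Rohrlich's theorem at ANY prime (`PSRohrlichAtLevel.rohrlich_primePow_of_coeffBound`, companion
`CyclotomicUntwistRohrlichAtLevel`) and Birch's formula for the RATIONAL plus symbols
(`ratTwistedSymbolSum_mul_plusPeriod_holds`: `(∑ χ(a)[a/m]⁺_f)·Ω⁺_f = τ(χ)·L(f, χ̄, 1)`, `χ` even primitive):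

* `exists_forall_ratTwistedSymbolSum_ne_zero_complex` — rational normalised newform `f`,
  `|aₙ| ≤ C n^θ` (`θ < 2/3`), ANY prime `p`: there is `m₀` with `∑_{a mod p^m} χ(a)[a/p^m]⁺_f ≠ 0` for
  EVERY even primitive `χ : (ℤ/p^m)ˣ → ℂ`, `m ≥ m₀` (no order condition);
* `exists_forall_ratTwistedSymbolSum_ne_zero` — the same for characters with values in ANY field `K`
  of characteristic `0` with enough roots of unity that embeds `ℚ̄`… stated for `K = ℂ_p`
  (`exists_ringHomComp_eq_padic`, transport of the rational symbols along `ℚ̄ → ℂ`, `ℚ̄ → ℂ_p`);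
* `exists_forall_ratTwistedSymbolSum_ne_zero_of_isNewformOf` — for the newform of an elliptic curve;
* `ne_zero_of_isMultPAdicLFunctionOf` — **at a prime `p` (multiplicative for `E`, or any `p` at which a
  power series with the package exists): `IsMultPAdicLFunctionOf f p α L`, `α ≠ 0`, `IsNewformOf W f`
  ⇒ `L ≠ 0`** (Mazur–Tate–Teitelbaum 1986 §I.10 with `ε(p) = 0`; Greenberg 1999 §1 deduces `L_p ≠ 0`
  from Rohrlich — here at a prime DIVIDING the level, where the 1984 theorem did not apply), and the
  cofinite form `exists_forall_interpolation_ne_zero_of_isMultPAdicLFunctionOf`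
  (`α^{-m} ∑ χ(a)[a/p^m]⁺_f ≠ 0` for all wild `χ` of conductor `p^m`, `m ≥ m₀`).

References: D. E. Rohrlich, Invent. Math. 75 (1984) [cite: RohrlichInventiones1984, Theorem (p. 409)];
B. Mazur, J. Tate, J. Teitelbaum, Invent. Math. 84 (1986), §I.8 (8.6), §I.10, §I.14
[cite: MazurTateTeitelbaum1986Invent, §I.14]; R. Greenberg, LNM 1716 (1999), §1, §4.
-/

noncomputable section

open scoped BigOperators

open CongruenceSubgroup DirichletCharacter Literature.NumberTheory.EllipticCurves
  Literature.NumberTheory.EllipticCurves.ModularForms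
  Summit.BirchSwinnertonDyer.BirchSwinnertonDyer.Theorems.PSRohrlichAtLevel
  Summit.BirchSwinnertonDyer.BirchSwinnertonDyer.Theorems.PSUntwistNonvanishingCofinite

-- single-conjunct summit: `Summit.BirchSwinnertonDyer.BirchSwinnertonDyer.…` repeats the name by design
set_option linter.dupNamespace false
set_option autoImplicit false

namespace Summit.BirchSwinnertonDyer.BirchSwinnertonDyer.Theorems.PSTwistedSymbolSumsCofinite

variable {p : ℕ} [hp : Fact p.Prime] {N : ℕ} [NeZero N] {f : CuspForm (Gamma0 N) 2}

/-- **Cofinite non-vanishing of the complex twisted plus-symbol sums** (rational newforms, ANY prime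
`p`). For `f ∈ S₂(Γ₀(N))` a normalised newform with rational coefficients and `|aₙ| ≤ C n^θ`
(`θ < 2/3`): there is `m₀` such that `∑_{a mod p^m} χ(a)[a/p^m]⁺_f ≠ 0` for every even primitive
`χ` mod `p^m` with values in `ℂ`, `m ≥ m₀` — Birch (`ratTwistedSymbolSum_mul_plusPeriod_holds`,
`τ(χ) ≠ 0`) turns a vanishing sum into `L(f, χ̄, 1) = 0`, and the exceptional set of Rohrlich's theorem
at `p` (`rohrlich_primePow_of_coeffBound`, `p ∣ N` allowed) has bounded levels.
[cite: RohrlichInventiones1984, Theorem (p. 409)] -/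
theorem exists_forall_ratTwistedSymbolSum_ne_zero_complex (hf : IsNewform0 f) (hQ : coeffField f = ⊥)
    {C θ : ℝ} (hC : 0 ≤ C) (hθ : 0 < θ) (hθ1 : θ < 2 / 3)
    (ha : ∀ n : ℕ, ‖cuspCoeff f n‖ ≤ C * (n : ℝ) ^ θ) :
    ∃ m₀ : ℕ, ∀ m : ℕ, m₀ ≤ m → ∀ χ : DirichletCharacter ℂ (p ^ m), χ.IsPrimitive → χ.Even →
      ratTwistedSymbolSum f χ ≠ 0 := by
  have hp' : p.Prime := Fact.out
  have hfin := rohrlich_primePow_of_coeffBound (p := p) hf hQ hC hθ hθ1 ha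
  obtain ⟨B, hB⟩ := (hfin.image Sigma.fst).bddAbove
  refine ⟨B + 1, fun m hm χ hχ hχe hzero ↦ ?_⟩
  have hmB : B < p ^ m :=
    lt_of_lt_of_le (lt_of_lt_of_le (Nat.lt_succ_self B) hm) (le_of_lt (Nat.lt_pow_self hp'.one_lt))
  haveI : NeZero (p ^ m) := ⟨pow_ne_zero _ hp'.ne_zero⟩
  obtain ⟨L, hLd, hL⟩ := exists_differentiable_eq_twistedLSeries_holds f χ⁻¹
  have hBirch := ratTwistedSymbolSum_mul_plusPeriod_holds (f := f) hf hQ hχ hχe hLd hL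
  rw [hzero, zero_mul, eq_comm, mul_eq_zero] at hBirch
  have hL1 : L 1 = 0 := hBirch.resolve_left (gaussSum_stdAddChar_ne_zero hχ)
  have hinvprim : DirichletCharacter.IsPrimitive χ⁻¹ := by
    rw [DirichletCharacter.isPrimitive_def, DirichletCharacter.conductor_inv]; exact hχ
  have hmem : (⟨p ^ m, χ⁻¹⟩ : Σ n : ℕ, DirichletCharacter ℂ n) ∈
      {χ : Σ n : ℕ, DirichletCharacter ℂ n |
        χ.1 ≠ 0 ∧ χ.1.primeFactors ⊆ {p} ∧ χ.2.IsPrimitive ∧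
          ∃ L : ℂ → ℂ, Differentiable ℂ L ∧
            (∀ s : ℂ, 2 < s.re → L s = twistedLSeries f χ.2 s) ∧ L 1 = 0} :=
    ⟨pow_ne_zero _ hp'.ne_zero, (Nat.primeFactors_prime_pow (by omega) hp').le, hinvprim,
      L, hLd, hL, hL1⟩
  have hle : p ^ m ≤ B := hB (Set.mem_image_of_mem Sigma.fst hmem)
  omega

/-- **Cofinite non-vanishing of the `ℂ_p`-valued twisted plus-symbol sums** (rational newforms, ANY
prime `p`): as `exists_forall_ratTwistedSymbolSum_ne_zero_complex`, for even primitive characters with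
values in `ℂ_p` — transport `ℂ_p ← ℚ̄ → ℂ` of the RATIONAL symbols (`exists_ringHomComp_eq_padic`,
`ratTwistedSymbolSum_ringHomComp`). [cite: RohrlichInventiones1984, Theorem (p. 409)] -/
theorem exists_forall_ratTwistedSymbolSum_ne_zero (hf : IsNewform0 f) (hQ : coeffField f = ⊥)
    {C θ : ℝ} (hC : 0 ≤ C) (hθ : 0 < θ) (hθ1 : θ < 2 / 3)
    (ha : ∀ n : ℕ, ‖cuspCoeff f n‖ ≤ C * (n : ℝ) ^ θ) :
    ∃ m₀ : ℕ, ∀ m : ℕ, m₀ ≤ m → ∀ χ : DirichletCharacter ℂ_[p] (p ^ m), χ.IsPrimitive → χ.Even →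
      ratTwistedSymbolSum f χ ≠ 0 := by
  have hp' : p.Prime := Fact.out
  obtain ⟨m₀, hm₀⟩ := exists_forall_ratTwistedSymbolSum_ne_zero_complex (p := p) hf hQ hC hθ hθ1 ha
  refine ⟨m₀, fun m hm χ hχ hχe hzero ↦ ?_⟩
  haveI : NeZero (p ^ m) := ⟨pow_ne_zero _ hp'.ne_zero⟩
  let K := AlgebraicClosure ℚ
  let σ : K →+* ℂ := (@IsAlgClosed.lift ℂ _ _ ℚ _ _ K _ _ (AlgebraicClosure.instAlgebra ℚ) _ _ _
    (AlgebraicClosure.isAlgebraic ℚ)).toRingHom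
  let τ : K →+* ℂ_[p] := (@IsAlgClosed.lift ℂ_[p] _ _ ℚ _ _ K _ _
    (AlgebraicClosure.instAlgebra ℚ) _ _ _ (AlgebraicClosure.isAlgebraic ℚ)).toRingHom
  obtain ⟨ψ, hψ⟩ := exists_ringHomComp_eq_padic τ χ
  have hψprim : ψ.IsPrimitive := (isPrimitive_ringHomComp_iff τ ψ).mp (hψ ▸ hχ)
  have hψeven : ψ.Even := (even_ringHomComp_iff τ ψ).mp (hψ ▸ hχe)
  have hK : ratTwistedSymbolSum f ψ = 0 := by
    rw [← hψ, ratTwistedSymbolSum_ringHomComp, map_eq_zero] at hzero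
    exact hzero
  refine hm₀ m hm (ψ.ringHomComp σ) ((isPrimitive_ringHomComp_iff σ ψ).mpr hψprim)
    ((even_ringHomComp_iff σ ψ).mpr hψeven) ?_
  rw [ratTwistedSymbolSum_ringHomComp, hK, map_zero]

/-- **For the newform of an elliptic curve `E/ℚ` and ANY prime `p`**, the `ℂ_p`-valued twisted
plus-symbol sums `∑ χ(a)[a/p^m]⁺_f` are non-zero for every even primitive `χ` mod `p^m`, `m ≥ m₀(E, p)`
(Hasse bound `θ = 5/8`). [cite: RohrlichInventiones1984, Theorem (p. 409)] -/
theorem exists_forall_ratTwistedSymbolSum_ne_zero_of_isNewformOf {W : WeierstrassCurve ℚ}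
    [W.IsElliptic] (hfW : IsNewformOf W f) :
    ∃ m₀ : ℕ, ∀ m : ℕ, m₀ ≤ m → ∀ χ : DirichletCharacter ℂ_[p] (p ^ m), χ.IsPrimitive → χ.Even →
      ratTwistedSymbolSum f χ ≠ 0 :=
  exists_forall_ratTwistedSymbolSum_ne_zero hfW.1 hfW.coeffField_eq_bot (C := (16 : ℝ) ^ 256)
    (θ := 5 / 8) (by positivity) (by norm_num) (by norm_num)
    (fun n ↦ by rw [hfW.2 n]; exact W.norm_LFunction_le_rpow n)

/-! ### The `p`-adic `L`-function at a multiplicative prime is not zero -/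

/-- **Cofinite non-vanishing of the interpolation values of `L_p` at a prime `p ∣ N`.** If
`IsMultPAdicLFunctionOf f p α L` (Mazur–Tate–Teitelbaum's package at a prime with `ε(p) = 0`:
`L(ζ_χ − 1) = α^{-m} ∑ χ(a)[a/p^m]⁺_f` at the wild `χ` of conductor `p^m`) for the newform `f` of an
elliptic curve and `α ≠ 0`, then these interpolation values are non-zero for every wild `χ` of
conductor `p^m`, `m ≥ m₀`. [cite: MazurTateTeitelbaum1986Invent, §I.14] -/
theorem exists_forall_interpolation_ne_zero_of_isMultPAdicLFunctionOf {W : WeierstrassCurve ℚ}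
    [W.IsElliptic] (hfW : IsNewformOf W f) {α : ℚ_[p]} (hα : α ≠ 0) :
    ∃ m₀ : ℕ, ∀ m : ℕ, m₀ ≤ m → ∀ χ : DirichletCharacter ℂ_[p] (p ^ m), χ.IsPrimitive → χ.Even →
      algebraMap ℚ_[p] ℂ_[p] (α⁻¹ ^ m) * ratTwistedSymbolSum f χ ≠ 0 := by
  obtain ⟨m₀, hm₀⟩ := exists_forall_ratTwistedSymbolSum_ne_zero_of_isNewformOf (p := p) hfW
  refine ⟨m₀, fun m hm χ hχ hχe ↦ mul_ne_zero ?_ (hm₀ m hm χ hχ hχe)⟩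
  exact (_root_.map_ne_zero _).mpr (pow_ne_zero _ (inv_ne_zero hα))

/-- **`L_p(E, T) ≠ 0` at a prime dividing the level** (in particular at a prime of multiplicative
reduction, `α = a_p = ±1`). If `L` satisfies the Mazur–Tate–Teitelbaum package
`IsMultPAdicLFunctionOf f p α L` for the newform `f` of an elliptic curve `E/ℚ` with `α ≠ 0`, then
`L ≠ 0`: were `L = 0`, every interpolation value `α^{-m} ∑ χ(a)[a/p^m]⁺_f` (`m ≥ 1`, `χ` wild) would
vanish (`HasSum` of the zero series), contradicting
`exists_forall_interpolation_ne_zero_of_isMultPAdicLFunctionOf` at a wild character of large conductor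
(`exists_isPrimitive_even_orderOf_eq_prime_pow`). Greenberg 1999 §1 obtains this from Rohrlich's
theorem at `p ∤ N`; at `p ∣ N` the input is `rohrlich_primePow_of_isNewformOf`.
[cite: MazurTateTeitelbaum1986Invent, §I.14] -/
theorem ne_zero_of_isMultPAdicLFunctionOf {W : WeierstrassCurve ℚ} [W.IsElliptic]
    (hfW : IsNewformOf W f) {α : ℚ_[p]} (hα : α ≠ 0) {L : PowerSeries ℚ_[p]}
    (hL : IsMultPAdicLFunctionOf f p α L) : L ≠ 0 := by
  intro hL0
  have hp' : p.Prime := Fact.out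
  obtain ⟨m₀, hm₀⟩ := exists_forall_interpolation_ne_zero_of_isMultPAdicLFunctionOf (p := p) hfW hα
  -- a wild character of conductor `p^{m₀ + 3}`
  haveI : NeZero ((Nat.totient (p ^ (m₀ + 3)) : ℕ) : ℂ_[p]) :=
    ⟨Nat.cast_ne_zero.mpr (Nat.totient_pos.mpr (pow_pos hp'.pos _)).ne'⟩
  obtain ⟨χ, hχ, hχe, hχo⟩ := exists_isPrimitive_even_orderOf_eq_prime_pow ℂ_[p] (p := p) m₀
  have hint := hL.2.2 (m₀ + 3) (by omega) χ hχ hχe hχo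
  rw [hL0] at hint
  simp only [map_zero, zero_mul] at hint
  have h0 := hint.unique hasSum_zero
  exact hm₀ (m₀ + 3) (by omega) χ hχ hχe h0

end Summit.BirchSwinnertonDyer.BirchSwinnertonDyer.Theorems.PSTwistedSymbolSumsCofinite

end
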